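import Mathlib
import Literature.AlgebraicGeometry.Resolution.CobordantGame
import Summits.ResolutionOfSingularities.ResolutionOfSingularities.Theorems.WeightedInvariantLocalWeightedDropGradedSliceTwistedSuccessor

/-!
# `WeightedInvariant.LocalWeightedDrop`: the wild slice clause — twisted cylinders under saturated moves, part 2:
# PRE-SCALING TO EXACT SATURATION, LATTICE PROPAGATION, CONVERSE BOOKKEEPING

Route `ResolutionOfSingularities/WeightedInvariant`, crux `LocalWeightedDrop` (stmt-ResolutionOfSingularities-8899).
[OURS · L1 W4.3] — res-type-060 (gen 10), WILD LIBRARY file 17, companion of `…GradedSliceTwistedSuccessor` (file 16: the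
normal form TC(G, h, τ, a) `subst (frobFamily n q) G = (1 + X last)^a * subst (scaleFam τ) h`, the chart identity and
`isSuccessorAt_of_twistedCyl` under EXACT pointwise saturation `τⱼ = m·Wⱼ` on the translated coordinates).  Nothing here is a
statement of the manuscript under review on ladder RESOLUTION; not a verdict on card A.  AI proof, weaker than expert review.

* §1 `coeff_single_last_eq_zero_of_twistedCyl` — under TC(G₁, h₁, τ₁, a′) the idle linear coefficient of `G₁` is a multiple of
  `h₁(0)`: with the agreement of constant and old linear coefficients (file 16) the SINGULAR successors of `G` and of `h`
  correspond exactly.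
* §2 the downstairs scaling `D_K = (xⱼ ↦ (1+y)^{Kⱼ}xⱼ, y ↦ y)` (as the def-free family `Fin.snoc (scaleFam K) (X last)`): zero
  constants, linear part `1`, GRADED for every lattice in which `y` has trivial character (`isLGradedMove_snoc_scaleFam`), and
  **`twistedCyl_upScale`**: TC(G, h, τ, a) ⇒ TC(G(D_K), h, τ + q·K, a) in any ring with `(1+y)^q = 1 + y^q`; with
  **`exists_exact_saturation`** (arithmetic) a congruence `τⱼ ≡ m·Wⱼ (mod q)` on the translated coordinates of a point becomes,
  after such a scaling and enlarging `m`, the exact dominant saturation that file 16 consumes — so POINTWISE SATURATION MOD `q`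
  (= the point is fixed by the twist group `μ_q` up to the new torus) is all the same-rank step needs.
* §3 **`dvd_tauDot_succLattice`** — if `q ∣ τ·r` for every character `r` of the slice lattice `L` (the hypothesis under which
  `L`-graded coordinate changes conjugate through the twist, res-type-099's part 2), then `q ∣ τ₁·r` for every character of
  `succLattice L W c'`, `τ₁ = succTau τ W m`: the hypothesis reproduces one move down.
-/

set_option linter.dupNamespace false -- mandated namespace of this single-conjunct summit
set_option autoImplicit false

namespace Summit.ResolutionOfSingularities.ResolutionOfSingularities.Theorems

namespace GradedGame

open MvPowerSeries
open Literature.AlgebraicGeometry.Resolution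
open Literature.AlgebraicGeometry.Resolution.FormalCoordChange (linMat)

variable {k : Type} [Field k]

/-! ## §1 Converse bookkeeping -/

/-- Converse bookkeeping: under TC(G₁, h₁, τ₁, a′) the idle linear coefficient of `G₁` is a multiple of `h₁(0)` — so a SINGULAR
`h₁` has a singular twisted partner (together with the agreement of constant and old linear coefficients in the proof above, the
singular successors of `G` and of `h` correspond exactly). [OURS · L1 W4.3] -/
theorem coeff_single_last_eq_zero_of_twistedCyl {M : ℕ} (q : ℕ) (hq : 0 < q) (σ : Fin (M + 1) → ℕ) (a' : ℕ)
    (h₁ : MvPowerSeries (Fin (M + 1)) k) (G₁ : MvPowerSeries (Fin (M + 1 + 1)) k)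
    (hTC : subst (frobFamily (k := k) M q) G₁ = (1 + X (Fin.last (M + 1))) ^ a' * subst (scaleFam (k := k) σ) h₁)
    (h0 : constantCoeff h₁ = 0) :
    coeff (Finsupp.single (Fin.last (M + 1)) 1) G₁ = 0 := by
  classical
  have hlin : (Finsupp.single (Fin.last (M + 1)) q : Fin (M + 1 + 1) →₀ ℕ) =
      linExp (frobExp (M + 1) q) (Finsupp.single (Fin.last (M + 1)) 1) := by
    ext v
    refine Fin.lastCases ?_ (fun j => ?_) v
    · rw [linExp_frobExp_last, Finsupp.single_eq_same, Finsupp.single_eq_same, one_mul]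
    · rw [linExp_frobExp_castSucc, Finsupp.single_apply, Finsupp.single_apply,
        if_neg (Fin.castSucc_lt_last j).ne', if_neg (Fin.castSucc_lt_last j).ne']
  have h := coeff_linExp_subst_frobFamily M q hq G₁ (Finsupp.single (Fin.last (M + 1)) 1)
  rw [← hlin, hTC, coeff_mul] at h
  rw [← h]
  refine Finset.sum_eq_zero fun x hx => ?_
  have hsum : x.1 + x.2 = Finsupp.single (Fin.last (M + 1)) q := Finset.HasAntidiagonal.mem_antidiagonal.mp hx
  -- the second factor sits on the idle axis, where the scaled series has coefficients `h₁(0)·(…) = 0`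
  have hx2 : x.2 = Finsupp.single (Fin.last (M + 1)) (x.2 (Fin.last (M + 1))) := by
    ext v
    refine Fin.lastCases ?_ (fun j => ?_) v
    · rw [Finsupp.single_eq_same]
    · have := DFunLike.congr_fun hsum (Fin.castSucc j)
      rw [Finsupp.add_apply, Finsupp.single_apply, if_neg (Fin.castSucc_lt_last j).ne'] at this
      rw [Finsupp.single_apply, if_neg (Fin.castSucc_lt_last j).ne']
      omega
  rw [hx2, coeff_single_last_subst_scaleFam, h0, zero_mul, mul_zero]

/-! ## §2 Pre-scaling: reaching exact saturation from a congruence -/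

section UpScale

variable {n : ℕ} (q : ℕ) (τ : Fin (n + 1) → ℕ) (a : ℕ) (K : Fin (n + 1) → ℕ)

/-- The downstairs scaling `xⱼ ↦ (1+y)^{Kⱼ}·xⱼ`, `y ↦ y`, on an old coordinate. [OURS · L1 W4.3] -/
theorem snoc_scaleFam_castSucc (j : Fin (n + 1)) :
    (Fin.snoc (scaleFam (k := k) K) (X (Fin.last (n + 1))) : Fin (n + 1 + 1) → MvPowerSeries (Fin (n + 1 + 1)) k)
      (Fin.castSucc j) = (1 + X (Fin.last (n + 1))) ^ (K j) * X (Fin.castSucc j) := by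
  rw [Fin.snoc_castSucc]; rfl

/-- … and on the idle coordinate. [OURS · L1 W4.3] -/
theorem snoc_scaleFam_last :
    (Fin.snoc (scaleFam (k := k) K) (X (Fin.last (n + 1))) : Fin (n + 1 + 1) → MvPowerSeries (Fin (n + 1 + 1)) k)
      (Fin.last (n + 1)) = X (Fin.last (n + 1)) := by
  rw [Fin.snoc_last]

/-- The downstairs scaling has zero constant terms. [OURS · L1 W4.3] -/
theorem constantCoeff_snoc_scaleFam (i : Fin (n + 1 + 1)) :
    constantCoeff ((Fin.snoc (scaleFam (k := k) K) (X (Fin.last (n + 1))) :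
      Fin (n + 1 + 1) → MvPowerSeries (Fin (n + 1 + 1)) k) i) = 0 := by
  refine Fin.lastCases ?_ (fun j => ?_) i
  · rw [snoc_scaleFam_last]; exact constantCoeff_X _
  · rw [snoc_scaleFam_castSucc]; simp [constantCoeff_X]

/-- … hence is substitutable. [OURS · L1 W4.3] -/
theorem hasSubst_snoc_scaleFam :
    HasSubst (Fin.snoc (scaleFam (k := k) K) (X (Fin.last (n + 1))) : Fin (n + 1 + 1) → MvPowerSeries (Fin (n + 1 + 1)) k) :=
  hasSubst_of_constantCoeff_zero (constantCoeff_snoc_scaleFam K)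

/-- The downstairs scaling is tangent to the identity. [OURS · L1 W4.3] -/
theorem linMat_snoc_scaleFam :
    linMat (Fin.snoc (scaleFam (k := k) K) (X (Fin.last (n + 1))) : Fin (n + 1 + 1) → MvPowerSeries (Fin (n + 1 + 1)) k) = 1 := by
  ext i j
  change coeff (Finsupp.single j 1) ((Fin.snoc (scaleFam (k := k) K) (X (Fin.last (n + 1))) :
    Fin (n + 1 + 1) → MvPowerSeries (Fin (n + 1 + 1)) k) i) = _
  rw [Matrix.one_apply]
  revert j
  refine Fin.lastCases ?_ (fun l => ?_) i
  · intro j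
    rw [snoc_scaleFam_last, coeff_X]
    by_cases hj : Fin.last (n + 1) = j
    · subst hj; rw [if_pos rfl, if_pos rfl]
    · rw [if_neg hj, if_neg]
      exact fun h' => hj ((Finsupp.single_left_inj one_ne_zero).mp h').symm
  · intro j
    rw [snoc_scaleFam_castSucc, mul_comm, coeff_single_X_mul, map_pow, map_add, map_one, constantCoeff_X, add_zero, one_pow]
    by_cases hj : Fin.castSucc l = j
    · subst hj; simp
    · rw [if_neg hj, if_neg (Ne.symm hj)]

/-- … so its linear part is invertible. [OURS · L1 W4.3] -/
theorem isUnit_det_linMat_snoc_scaleFam :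
    IsUnit (linMat (Fin.snoc (scaleFam (k := k) K) (X (Fin.last (n + 1))) :
      Fin (n + 1 + 1) → MvPowerSeries (Fin (n + 1 + 1)) k)).det := by
  rw [linMat_snoc_scaleFam, Matrix.det_one]; exact isUnit_one

/-- The downstairs scaling is GRADED for every lattice in which the idle coordinate has trivial character. [OURS · L1 W4.3] -/
theorem snoc_scaleFam_graded (Lt : AddSubgroup (Fin (n + 1 + 1) → ℤ)) (hlast : (Pi.single (Fin.last (n + 1)) 1 : Fin (n + 1 + 1) → ℤ) ∈ Lt) :
    ∀ i (e : Fin (n + 1 + 1) →₀ ℕ),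
      coeff e ((Fin.snoc (scaleFam (k := k) K) (X (Fin.last (n + 1))) : Fin (n + 1 + 1) → MvPowerSeries (Fin (n + 1 + 1)) k) i) ≠ 0 →
        expVec e - Pi.single i 1 ∈ Lt := by
  intro i
  refine Fin.lastCases ?_ (fun l => ?_) i
  · rw [snoc_scaleFam_last]; exact homDeg_X Lt _
  · rw [snoc_scaleFam_castSucc]
    intro e he
    have h := homDeg_mul Lt (homDeg_one_add_X_pow Lt _ hlast (K l)) (homDeg_X Lt (Fin.castSucc l)) e he
    rwa [zero_add] at h

/-- The downstairs scaling is a legal graded move (with any weights having a positive entry). [OURS · L1 W4.3] -/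
theorem isLGradedMove_snoc_scaleFam (Lt : AddSubgroup (Fin (n + 1 + 1) → ℤ))
    (hlast : (Pi.single (Fin.last (n + 1)) 1 : Fin (n + 1 + 1) → ℤ) ∈ Lt) (w : Fin (n + 1 + 1) → ℕ) (hw : ∃ i, 0 < w i) :
    IsLGradedMove Lt (Fin.snoc (scaleFam (k := k) K) (X (Fin.last (n + 1)))) w :=
  ⟨⟨constantCoeff_snoc_scaleFam K, isUnit_det_linMat_snoc_scaleFam K, hw⟩, snoc_scaleFam_graded K Lt hlast⟩

/-- **UP-SCALING A TWISTED CYLINDER**: TC(G, h, τ, a) ⇒ TC(G(xⱼ ↦ (1+y)^{Kⱼ}xⱼ), h, τ + q·K, a), in any ring with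
`(1+y)^q = 1 + y^q`. [OURS · L1 W4.3] -/
theorem twistedCyl_upScale (hq : 0 < q)
    (hfrob : ((1 : MvPowerSeries (Fin (n + 1 + 1)) k) + X (Fin.last (n + 1))) ^ q = 1 + X (Fin.last (n + 1)) ^ q)
    (h : MvPowerSeries (Fin (n + 1)) k) (G : MvPowerSeries (Fin (n + 1 + 1)) k)
    (hTC : subst (frobFamily (k := k) n q) G = (1 + X (Fin.last (n + 1))) ^ a * subst (scaleFam (k := k) τ) h) :
    subst (frobFamily (k := k) n q) (subst (Fin.snoc (scaleFam (k := k) K) (X (Fin.last (n + 1)))) G) =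
      (1 + X (Fin.last (n + 1))) ^ a * subst (scaleFam (k := k) (τ + q • K)) h := by
  have hD := hasSubst_snoc_scaleFam (k := k) K
  have hD' := hasSubst_snoc_scaleFam (k := k) (q • K)
  have hF := hasSubst_frobFamily (k := k) (n := n) q hq
  have hcomm : subst (frobFamily (k := k) n q) (subst (Fin.snoc (scaleFam (k := k) K) (X (Fin.last (n + 1)))) G) =
      subst (Fin.snoc (scaleFam (k := k) (q • K)) (X (Fin.last (n + 1)))) (subst (frobFamily (k := k) n q) G) := by
    rw [subst_comp_subst_apply hD hF, subst_comp_subst_apply hF hD']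
    congr 1
    funext i
    refine Fin.lastCases ?_ (fun j => ?_) i
    · rw [snoc_scaleFam_last, subst_X hF, frobFamily_last, subst_pow hD', subst_X hD', snoc_scaleFam_last]
    · rw [snoc_scaleFam_castSucc, frobFamily_of_ne_last q n _ (Fin.castSucc_lt_last j).ne, subst_X hD',
        snoc_scaleFam_castSucc, subst_mul hF, subst_pow hF, subst_add hF, subst_one' hF, subst_X hF, subst_X hF,
        frobFamily_last, frobFamily_of_ne_last q n _ (Fin.castSucc_lt_last j).ne, ← hfrob, ← pow_mul, Pi.smul_apply,
        smul_eq_mul]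
  rw [hcomm, hTC, subst_one_add_X_pow_mul hD', snoc_scaleFam_last, subst_comp_subst_apply (hasSubst_scaleFam τ) hD']
  congr 1
  congr 1
  funext j
  rw [scaleFam_apply, subst_mul hD', subst_pow hD', subst_add hD', subst_one' hD', subst_X hD', subst_X hD',
    snoc_scaleFam_last, snoc_scaleFam_castSucc, scaleFam_apply, Pi.add_apply, Pi.smul_apply, smul_eq_mul, pow_add]
  ring

/-- **EXACT SATURATION FROM A CONGRUENCE** (arithmetic): if `τⱼ ≡ m·Wⱼ (mod q)` on the translated coordinates, then for some
`m' ≥ m`-type integer and some up-scaling `K`, `τ + q·K` is EXACTLY `m'·W` on the translated coordinates and dominates `m'·W` on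
every blown-up coordinate. [OURS · L1 W4.3] -/
theorem exists_exact_saturation (hq : 0 < q) (W : Fin (n + 1) → ℕ) (γ : Fin (n + 1 + 1) → k) (m : ℕ)
    (hsat : ∀ j, γ (Fin.castSucc j) ≠ 0 → 0 < W j → τ j ≡ m * W j [MOD q]) :
    ∃ (m' : ℕ) (K : Fin (n + 1) → ℕ), m' ≡ m [MOD q] ∧ (∀ j, γ (Fin.castSucc j) ≠ 0 → 0 < W j → (τ + q • K) j = m' * W j) ∧
      (∀ j, 0 < W j → m' * W j ≤ (τ + q • K) j) := by
  classical
  set T : ℕ := ∑ j, τ j with hT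
  have hTj : ∀ j, τ j ≤ T := fun j => Finset.single_le_sum (fun i _ => Nat.zero_le (τ i)) (Finset.mem_univ j)
  set m' : ℕ := m + q * T with hm'
  have hmm : m' ≡ m [MOD q] :=
    ((Nat.modEq_iff_dvd' (Nat.le_add_right m (q * T))).mpr (by rw [Nat.add_sub_cancel_left]; exact Dvd.intro _ rfl)).symm
  have hbig : ∀ j, 0 < W j → τ j ≤ m' * W j := by
    intro j hw
    calc τ j ≤ T := hTj j
      _ ≤ q * T := Nat.le_mul_of_pos_left T hq
      _ ≤ q * T * W j := Nat.le_mul_of_pos_right _ hw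
      _ ≤ m' * W j := by rw [hm', add_mul]; exact Nat.le_add_left _ _
  have hmod' : ∀ j, γ (Fin.castSucc j) ≠ 0 → 0 < W j → τ j ≡ m' * W j [MOD q] := by
    intro j hc hw
    exact (hsat j hc hw).trans (Nat.ModEq.mul_right _ hmm.symm)
  have hexact : ∀ j, γ (Fin.castSucc j) ≠ 0 → 0 < W j → τ j + q * ((m' * W j - τ j) / q) = m' * W j := by
    intro j hc hw
    have hdvd : q ∣ m' * W j - τ j := (Nat.modEq_iff_dvd' (hbig j hw)).mp (hmod' j hc hw)
    rw [Nat.mul_div_cancel' hdvd, Nat.add_sub_cancel' (hbig j hw)]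
  refine ⟨m', fun j => if γ (Fin.castSucc j) ≠ 0 ∧ 0 < W j then (m' * W j - τ j) / q else m' * W j, hmm, ?_, ?_⟩
  · intro j hc hw
    rw [Pi.add_apply, Pi.smul_apply, smul_eq_mul, if_pos ⟨hc, hw⟩]
    exact hexact j hc hw
  · intro j hw
    rw [Pi.add_apply, Pi.smul_apply, smul_eq_mul]
    by_cases hc : γ (Fin.castSucc j) ≠ 0
    · rw [if_pos ⟨hc, hw⟩, hexact j hc hw]
    · rw [if_neg (fun h => hc h.1)]
      calc m' * W j ≤ q * (m' * W j) := Nat.le_mul_of_pos_left _ hq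
        _ ≤ τ j + q * (m' * W j) := Nat.le_add_left _ _

end UpScale

/-! ## §3 Lattice propagation: the twist congruence survives a saturated move -/

section Lattice

variable {n : ℕ} (q : ℕ) (τ : Fin (n + 1) → ℕ) (W : Fin (n + 1) → ℕ) (c' : Fin (n + 1) → k) (m : ℕ)

/-- **THE TWIST CONGRUENCE PROPAGATES**: if `q ∣ τ·r` for every character `r` of the slice lattice `L` (so that `L`-graded coordinate
changes commute with the twist through the Frobenius cover), then `q ∣ τ₁·r` for every character `r` of the propagated lattice
`succLattice L W c'`, `τ₁ = succTau τ W m`, under exact pointwise saturation at `c'`. [OURS · L1 W4.3] -/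
theorem dvd_tauDot_succLattice (L : AddSubgroup (Fin (n + 1) → ℤ))
    (hL : ∀ r ∈ L, (q : ℤ) ∣ ∑ j, (τ j : ℤ) * r j)
    (hsat : ∀ j, c' j ≠ 0 → 0 < W j → τ j = m * W j) (hdom : ∀ j, 0 < W j → m * W j ≤ τ j) :
    ∀ v ∈ succLattice L W c', (q : ℤ) ∣ ∑ i, (succTau τ W m i : ℤ) * v i := by
  intro v hv
  have hdom' : ∀ j, m * W j ≤ τ j := by
    intro j
    by_cases hw : 0 < W j
    · exact hdom j hw
    · rw [Nat.eq_zero_of_not_pos hw, mul_zero]; exact Nat.zero_le _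
  unfold succLattice at hv
  induction hv using AddSubgroup.closure_induction with
  | mem x hx =>
    rcases hx with ⟨r, hr, rfl⟩ | ⟨j, hcj, hwj, rfl⟩
    · rw [Fin.sum_univ_succ]
      simp only [Matrix.cons_val_zero, Matrix.cons_val_succ, succTau_zero, succTau_succ]
      have hre : ∀ j : Fin (n + 1), ((τ j - m * W j : ℕ) : ℤ) * r j = (τ j : ℤ) * r j - (m : ℤ) * ((W j : ℤ) * r j) := by
        intro j; rw [Nat.cast_sub (hdom' j), Nat.cast_mul]; ring
      simp_rw [hre]
      rw [Finset.sum_sub_distrib, Finset.mul_sum]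
      have : ∑ j, (m : ℤ) * ((W j : ℤ) * r j) + (∑ j, (τ j : ℤ) * r j - ∑ j, (m : ℤ) * ((W j : ℤ) * r j)) =
          ∑ j, (τ j : ℤ) * r j := by ring
      rw [this]
      exact hL r hr
    · rw [Finset.sum_eq_single j.succ]
      · rw [Pi.single_eq_same, mul_one, succTau_succ, hsat j hcj hwj, Nat.sub_self, Nat.cast_zero]
        exact dvd_zero _
      · intro i _ hi; rw [Pi.single_eq_of_ne hi, mul_zero]
      · intro h; exact absurd (Finset.mem_univ _) h
  | zero => simp
  | add x y _ _ hx hy =>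
    simp only [Pi.add_apply, mul_add, Finset.sum_add_distrib]
    exact dvd_add hx hy
  | neg x _ hx =>
    simp only [Pi.neg_apply, mul_neg, Finset.sum_neg_distrib]
    exact (dvd_neg).mpr hx

end Lattice

end GradedGame

end Summit.ResolutionOfSingularities.ResolutionOfSingularities.Theorems
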